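import Summits.BirchSwinnertonDyer.BirchSwinnertonDyer.Theorems.TameQuarticManinParityTameThreeOfNeronCongruence
import Literature.NumberTheory.EllipticCurves.ModularJacobianNeronLatticeCuspCriterion
import HarnessLib

/-!
# Route `TameQuarticManinParity`, LINE 42 (bsd-idea-3 g12): the print support LP42 `CuspRegularFormsMemTameNeronLattice`
# (stmt-BirchSwinnertonDyer-24100) is the named fact `exists_tameNeronFormsAt_latticeCriterion` (ČNS Prop. 5.14 +
# Thm. 6.12), BY NAME — so E41 ⟸ N42 ∧ that fact (`--supports` LP42; CONDITIONAL, closes nothing)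

Cell `pub/bsd-wall`, D-0145 line `route-BirchSwinnertonDyer-TeichmullerTwistDescent`, seat `bsd-line-ttd-p1` g15.
BSD is NOT proved by this; Manin's conjecture is not proved by this; LP42 stays OPEN as print debt (its signature is
unconditional; here it is derived from the cite-only Literature fact landed by typer tqmp-ty1 g35, p700626,
`cuspRegularForms_mem_tameNeronLattice_three`), and the crux N42 (`TprimeIIINeronCongruenceSaturation`, 24099) stays
OPEN. THEOREMS ONLY; no definition, no named fact restated, no `sorry`; axioms `propext`, `Classical.choice`,
`Quot.sound`.
-/

set_option autoImplicit false
-- D-0017: single-problem summit, so `Summit.BirchSwinnertonDyer.BirchSwinnertonDyer.…` repeats a namespace BY DESIGN.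
set_option linter.dupNamespace false

namespace Summit.BirchSwinnertonDyer.BirchSwinnertonDyer.Theorems.TameQuarticManinParity

open Summit.BirchSwinnertonDyer.BirchSwinnertonDyer.Theses.TameQuarticManinParity
open Literature.NumberTheory.EllipticCurves.ModularForms

/-- **LP42 from the named fact** (ČNS Prop. 5.14 + (6.2.1) + Thm. 6.12 as `exists_tameNeronFormsAt_latticeCriterion`):
the typer's `cuspRegularForms_mem_tameNeronLattice_three`, verbatim the route decl.
[cite: CesnaviciusNeururerSaha2023, Prop. 5.14 (p. 39); Thm. 5.15 (p. 40); Prop. 6.2 (p. 41); Thm. 6.12 (b) (p. 46)] -/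
theorem cuspRegularFormsMemTameNeronLattice_of_latticeCriterion (h : exists_tameNeronFormsAt_latticeCriterion) :
    CuspRegularFormsMemTameNeronLattice := by
  unfold CuspRegularFormsMemTameNeronLattice
  intro N _ hN
  exact cuspRegularForms_mem_tameNeronLattice_three h N hN

/-- **E41 ⟸ N42 ∧ the ČNS lattice criterion** (G42 with LP42 discharged by name).
[cite: AbbesUllmo1996, Lemme 3.1] [cite: CesnaviciusNeururerSaha2023, Prop. 5.14, Thm. 6.12 (b)] -/
theorem tprimeTameThreeOptimalManinUnit_of_neronCongruence_of_latticeCriterion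
    (h42 : TprimeIIINeronCongruenceSaturation) (h : exists_tameNeronFormsAt_latticeCriterion) :
    TprimeTameThreeOptimalManinUnit :=
  tprimeTameThreeOfNeronCongruence_proof h42 (cuspRegularFormsMemTameNeronLattice_of_latticeCriterion h)

end Summit.BirchSwinnertonDyer.BirchSwinnertonDyer.Theorems.TameQuarticManinParity
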